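import Mathlib
import Summits.ResolutionOfSingularities.ResolutionOfSingularities.Theorems.RadicialJungCleanModelsCleanSeqPatching
import Summits.ResolutionOfSingularities.ResolutionOfSingularities.Theorems.RadicialJungCleanModelsCleanPermissibleSeqPoint
import Summits.ResolutionOfSingularities.ResolutionOfSingularities.Theorems.RadicialJungCleanModelsCleanPermissibleSeqClean
import Summits.ResolutionOfSingularities.ResolutionOfSingularities.Theorems.MarkedTransferCampaignW46ThreefoldsTauTwoSlice
import Summits.ResolutionOfSingularities.ResolutionOfSingularities.Theorems.FrobeniusLadderFInjectiveMacaulayficationProp44OfOrderReducible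
import Literature.AlgebraicGeometry.Resolution.PointCentrePermissible
import HarnessLib

/-!
# Route `RadicialJung`, crux `CleanModels` (stmt-ResolutionOfSingularities-15917), line `Sketch` rev 35, stub 6 `stub_cleanProp44` (X44c):
# THE CLEAN ISOLATED `τ ≥ 2` SLICE — point blow-ups over an isolated `τ ≥ 2` point, in X44c's output currency

Work item (W2) of the memo `Cruxes/CleanModels/Lines/Sketch-memo-4e-cleanPermissible.md` §7: the clean twin of the W4.6 slice
✓ `CampaignW46.orderReducible_comap_of_isolated_two_le_tau` / `orderReducible_of_finite_two_le_tau` (`MarkedTransferCampaignW46ThreefoldsTauTwoSlice.lean`).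
The W4.6 chain device `CampaignW46.TauTwoChainState` is REUSED (no new definition): the clean data — the stage is integral, the structure map
dominant, and the sequence so far is CLEAN-permissible for the line of `G` — ride along as a proposition on the state.  All centres are closed
points, which are clean-permissible for free (✓ `IsCleanPermissibleSeq.cons_point`, the line being clean-regular at every stage by
✓ `IsCleanPermissibleSeq.cleanRegAt`).

* `exists_isCleanPermissibleSeq_lt_opens_of_seq` — END GAME: a clean-permissible sequence on `X` whose last transform has order `< m` over the
  open `V` gives the conclusion of X44c on `V` (restriction ✓ `IsCleanPermissibleSeq.exists_restrict_of_isOpenImmersion`).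
* `exists_next_clean` — THE STEP for a state carrying clean data, if the conclusion of X44c fails on `V`.
* `exists_isCleanPermissibleSeq_lt_comap_of_isolated_two_le_tau` — ONE BRANCH: `X` integral regular locally Noetherian, `char K(X) = p`, the
  line of `G` clean-regular everywhere, `x ∈ V` closed, the points of order `≥ m` in `V` reduce to `x` (`ord = m`, emb. dim `3`, `τ ≥ 2`,
  `𝒪_{X,x}` a G-ring) ⟹ the conclusion of X44c on `V` (else an infinite chain of `τ = 2` near points, ✓ `false_of_nearChain_tau_two`).
* `exists_isCleanPermissibleSeq_lt_of_finite_two_le_tau` — **THE CLEAN ISOLATED `τ ≥ 2` SLICE** (finite clean patching ✓ `…_of_finite_of_forall_nhds`).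

Honest framing: OURS; this is ONE of the four slices of a clean re-threading of `cossartPiltant2008_prop44_holds` (memo 4e §4/§7: the `τ = 1`
point slice, the regular-curve slice with its births, and clean reach-tidy remain); nothing here proves X44c, any case of `CleanModels`, or
resolution of singularities in characteristic `p`.
-/

noncomputable section

set_option linter.dupNamespace false -- mandated namespace of this single-conjunct summit

open CategoryTheory CategoryTheory.Limits AlgebraicGeometry TopologicalSpace IsLocalRing
open Literature.AlgebraicGeometry.Resolution Literature.AlgebraicGeometry.Motives
open Scheme.IdealSheafData

namespace Summit.ResolutionOfSingularities.ResolutionOfSingularities.Theorems.RadicialJung.CleanModels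

open CampaignW46 (TauTwoChainState spanFinrank_maximalIdeal_congr stalkTau_congr isGRing_stalk_congr exists_rsop_three)

/-! ## §0 The end game over an open -/

/-- **END GAME (clean): the conclusion of X44c OVER AN OPEN from a global clean-permissible sequence.**  If `σ : Z → X` with last transform
`J'` is a clean-permissible sequence for `(J, m)` and the line of `G`, and every point of `Z` of order `≥ m` maps OUTSIDE the open `V ⊆ X`, then
the restricted sequence over `V` (✓ `IsCleanPermissibleSeq.exists_restrict_of_isOpenImmersion`) brings the order of `J|_V` below `m`.
Clean twin of ✓ `CampaignW46.OrderReducible.comap_opens_of_seq`. [cite: BierstoneGrigorievMilmanWlodarczyk2011, Thm. 8.0.5] -/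
theorem exists_isCleanPermissibleSeq_lt_opens_of_seq {p : ℕ} {X Z : Scheme.{0}} [IsIntegral X] [IsIntegral Z] [IsLocallyNoetherian X]
    {J : X.IdealSheafData} {m : ℕ} {G : X.functionField} {σ : Z ⟶ X} [IsDominant σ] {J' : Z.IdealSheafData}
    (hseq : IsCleanPermissibleSeq p σ J m J' G) (V : X.Opens) [IsIntegral ((V : X.Opens) : Scheme.{0})] [IsDominant V.ι]
    (h : ∀ z : Z, (m : ℕ∞) ≤ idealOrder J' z → σ z ∉ (V : Set X)) :
    ∃ (V' : Scheme.{0}) (π : V' ⟶ V) (_ : IsIntegral V') (_ : IsDominant π) (K' : V'.IdealSheafData),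
      IsCleanPermissibleSeq p π (J.comap V.ι) m K' (RatFn.functionFieldMap V.ι G) ∧ ∀ y, idealOrder K' y < m := by
  obtain ⟨W', hW', πW, hπW, K', e', hseqW, he', hcomm, hK', hNW', hNZ⟩ := hseq.exists_restrict_of_isOpenImmersion inferInstance V.ι
  haveI := he'
  haveI := hNW'
  haveI := hNZ
  refine ⟨W', πW, hW', hπW, K', hseqW, fun w => ?_⟩
  rw [hK', idealOrder_comap_of_etale e' J' w]
  by_contra hge
  rw [not_lt] at hge
  refine h (e' w) hge ?_
  have hsq : σ (e' w) = V.ι (πW w) := by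
    rw [← Scheme.Hom.comp_apply, hcomm, Scheme.Hom.comp_apply]
  rw [hsq, ← Scheme.Opens.range_ι V]
  exact ⟨_, rfl⟩

/-! ## §1 The step, for a state of the W4.6 chain device carrying clean data -/

set_option maxHeartbeats 800000 in
-- one long assembly of the near-point theory at the new stage (as in the W4.6 original)
/-- **THE STEP (clean).**  `X₀` integral regular locally Noetherian, `char K(X₀) = p`, the line of `G` clean-regular at every point, `m ≥ 1`, and
the conclusion of X44c FAILS on the open `V`.  For a state `σ` of the W4.6 chain device whose stage is integral, structure map dominant and sequence
CLEAN-permissible, blowing up the closed point `x_n` (clean-permissible for free) produces a near point over `x_n` (else the clean sequence so far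
settles `V`, `exists_isCleanPermissibleSeq_lt_opens_of_seq`), so `τ(x_n) = 2`; the near point is unique, closed, of order `m`, embedding dimension
`3`, `τ ≥ 2` — a new state, again with clean data. [cite: CossartPiltant2008, Lemma 4.3; proof of Prop. 4.4] -/
theorem exists_next_clean {p : ℕ} (hp : p.Prime) {X₀ : Scheme.{0}} [IsIntegral X₀] [IsLocallyNoetherian X₀]
    [CharP X₀.functionField p] {J₀ : X₀.IdealSheafData} {m : ℕ} {V : X₀.Opens} {G : X₀.functionField}
    (hX₀ : Scheme.IsRegular X₀) (hG : ∀ x : X₀, CleanRegAt p (algebraMap (X₀.presheaf.stalk x) X₀.functionField) G) (hm : 1 ≤ m)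
    [IsIntegral ((V : X₀.Opens) : Scheme.{0})] [IsDominant V.ι]
    (hnot : ¬ ∃ (V' : Scheme.{0}) (π : V' ⟶ V) (_ : IsIntegral V') (_ : IsDominant π) (K' : V'.IdealSheafData),
      IsCleanPermissibleSeq p π (J₀.comap V.ι) m K' (RatFn.functionFieldMap V.ι G) ∧ ∀ y, idealOrder K' y < m)
    (σ : TauTwoChainState X₀ J₀ m V) [IsIntegral σ.X] [IsDominant σ.Φ] (hclean : IsCleanPermissibleSeq p σ.Φ J₀ m σ.J G) :
    ∃ (σ' : TauTwoChainState X₀ J₀ m V) (π : σ'.X ⟶ σ.X) (_ : IsIntegral σ'.X) (_ : IsDominant σ'.Φ),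
      IsCleanPermissibleSeq p σ'.Φ J₀ m σ'.J G ∧
      IsBlowup π (vanishingIdeal ⟨{σ.x}, σ.closed⟩) ∧
      σ'.J = controlledTransform π (vanishingIdeal ⟨{σ.x}, σ.closed⟩) σ.J m ∧
      π σ'.x = σ.x ∧ IsNear π (vanishingIdeal ⟨{σ.x}, σ.closed⟩) σ.J m σ'.x ∧
      (haveI := σ.reg σ.x; stalkTau σ.J σ.x m = 2) := by
  classical
  haveI : IsLocallyNoetherian σ.X := σ.locNoeth
  have hX : Scheme.IsRegular σ.X := σ.reg
  set D : Closeds σ.X := ⟨{σ.x}, σ.closed⟩ with hDdef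
  have hreg : Scheme.IsRegular (vanishingIdeal D).subscheme := CampaignW46.isRegular_subscheme_vanishingIdeal_singleton σ.closed
  have hint : IsIntegral (vanishingIdeal D).subscheme := isIntegral_subscheme_vanishingIdeal_singleton σ.closed
  have hY : ∀ y ∈ (D : Set σ.X), idealOrder σ.J y = m := fun y hy => by
    have hy' : y = σ.x := hy
    rw [hy']; exact σ.ord
  have hD : ∀ y ∈ (D : Set σ.X), (m : ℕ∞) ≤ idealOrder σ.J y := fun y hy => (hY y hy).ge
  -- the centre is not the zero ideal (the embedding dimension at `x_n` is `3`)
  have hDbot : vanishingIdeal D ≠ ⊥ := by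
    intro hbot
    have h1 : maximalIdeal (σ.X.presheaf.stalk σ.x) = ⊥ := by
      rw [← stalkIdeal_vanishingIdeal_singleton σ.closed, ← hDdef, hbot, stalkIdeal_bot]
    have h2 := σ.dim
    rw [h1, Submodule.spanFinrank_bot] at h2
    exact absurd h2 (by norm_num)
  -- the blowing up of the point and the next stage of the sequences
  set π := blowup.π (vanishingIdeal D) with hπdef
  have hπ : IsBlowup π (vanishingIdeal D) := blowup.isBlowup _
  haveI : IsIntegral (blowup (vanishingIdeal D)) := hπ.isIntegral hDbot
  haveI : IsDominant π := isDominant_of_isBlowup_of_ne_bot hπ hDbot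
  have hseq' : CampaignW46.IsPermissibleBlowupSeq J₀ m (π ≫ σ.Φ) (controlledTransform π (vanishingIdeal D) σ.J m) :=
    σ.seq.blowup D π hreg hD hπ
  have hcleanx : CleanRegAt p (algebraMap (σ.X.presheaf.stalk σ.x) σ.X.functionField) (RatFn.functionFieldMap σ.Φ G) :=
    hclean.cleanRegAt hp inferInstance hG σ.x
  have hclean' : IsCleanPermissibleSeq p (π ≫ σ.Φ) J₀ m (controlledTransform π (vanishingIdeal D) σ.J m) G :=
    IsCleanPermissibleSeq.cons_point hp π σ.Φ J₀ m σ.J G hclean σ.x σ.closed hint hreg σ.ord hπ hcleanx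
  obtain ⟨hN', hR'⟩ := hseq'.isLocallyNoetherian_and_isRegular inferInstance hX₀
  haveI := hN'
  set J' := controlledTransform π (vanishingIdeal D) σ.J m with hJ'def
  -- the points of `X'` of order `≥ m` off the fibre of `x_n` map outside `V`
  have hoff : ∀ z : blowup (vanishingIdeal D), π z ≠ σ.x → (m : ℕ∞) ≤ idealOrder J' z → (π ≫ σ.Φ) z ∉ (V : Set X₀) := by
    intro z hπz hz
    have hz' : π z ∉ ((vanishingIdeal D).support : Set σ.X) := by
      rw [Scheme.IdealSheafData.coe_support_vanishingIdeal]; exact hπz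
    rw [hJ'def, hπ.idealOrder_controlledTransform_of_not_mem σ.J m hz'] at hz
    rcases σ.bad (π z) hz with h | h
    · exact absurd h hπz
    · rwa [Scheme.Hom.comp_apply]
  -- points over `x_n` of order `≥ m` are near
  have hnear_of : ∀ z : blowup (vanishingIdeal D), π z = σ.x → (m : ℕ∞) ≤ idealOrder J' z →
      IsNear π (vanishingIdeal D) σ.J m z := by
    intro z hπz hz
    have hle := hπ.idealOrder_controlledTransform_le_of_mem hX hreg hY (x' := z) (by rw [hπz]; rfl)
    exact isNear_iff.mpr (le_antisymm hle hz)
  -- a near point exists, or the clean sequence so far settles `V`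
  have hex : ∃ x', π x' = σ.x ∧ IsNear π (vanishingIdeal D) σ.J m x' := by
    by_contra hne
    push Not at hne
    refine hnot (exists_isCleanPermissibleSeq_lt_opens_of_seq hclean' V fun z hz => ?_)
    by_cases hπz : π z = σ.x
    · exact absurd (hnear_of z hπz hz) (hne z hπz)
    · exact hoff z hπz hz
  obtain ⟨x', hx', hnear⟩ := hex
  -- the data at `x_n`, read at the point `π x'`
  haveI : IsRegularLocalRing (σ.X.presheaf.stalk (π x')) := hX (π x')
  haveI : IsRegularLocalRing ((blowup (vanishingIdeal D)).presheaf.stalk x') := hR' x'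
  have hcl : IsClosed ({π x'} : Set σ.X) := by rw [hx']; exact σ.closed
  have hDeq : D = ⟨{π x'}, hcl⟩ := Closeds.ext (by change ({σ.x} : Set σ.X) = {π x'}; rw [hx'])
  have hd : (maximalIdeal (σ.X.presheaf.stalk (π x'))).spanFinrank = 3 := by
    rw [spanFinrank_maximalIdeal_congr hx']; exact σ.dim
  obtain ⟨c, hc, hcY⟩ := exists_rsop_three hcl hd
  rw [← hDeq] at hcY
  have hτ2 : 2 ≤ stalkTau σ.J (π x') m := by
    have h := σ.tau
    rwa [← stalkTau_congr hX σ.J m hx'] at h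
  have hτ : stalkTau σ.J (π x') m = 2 :=
    le_antisymm (hπ.stalkTau_le_two_of_isNear_point hd hc hcY hnear) hτ2
  -- the invariants at the near point
  have hclosed' : IsClosed ({x'} : Set (blowup (vanishingIdeal D))) :=
    hπ.isClosed_singleton_of_isNear_point hX hR' hreg hY hcl hd hc hcY hτ hnear
  have hdim' : (maximalIdeal ((blowup (vanishingIdeal D)).presheaf.stalk x')).spanFinrank = 3 :=
    hπ.spanFinrank_eq_three_of_isNear_point hd hc hcY hτ hnear
  have htau' : 2 ≤ stalkTau J' x' m := by
    have h := hπ.stalkTau_le_stalkTau_of_isNear_point hm hd hc hcY hτ hnear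
    rwa [hτ] at h
  have hbad' : ∀ z : blowup (vanishingIdeal D), (m : ℕ∞) ≤ idealOrder J' z → z = x' ∨ (π ≫ σ.Φ) z ∉ (V : Set X₀) := by
    intro z hz
    by_cases hπz : π z = σ.x
    · left
      have hnz := hnear_of z hπz hz
      exact hπ.eq_of_isNear_of_isNear_point hd hc hcY hτ hnear hnz (hπz.trans hx'.symm)
    · exact Or.inr (hoff z hπz hz)
  refine ⟨⟨blowup (vanishingIdeal D), J', x', π ≫ σ.Φ, hN', hR', hseq', hclosed', hbad', isNear_iff.mp hnear, hdim', htau'⟩, π,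
    inferInstance, inferInstance, hclean', hπ, rfl, hx', hnear, ?_⟩
  rw [stalkTau_congr hX σ.J m hx'.symm]; exact hτ

/-! ## §2 One branch: an isolated `τ ≥ 2` point -/

set_option maxHeartbeats 800000 in
-- the chain hypotheses of `false_of_nearChain_tau_two` are many; each is a transport along `π_n x_{n+1} = x_n`
/-- **ONE BRANCH (clean).**  `X` integral regular locally Noetherian with `char K(X) = p`, the line of `G` clean-regular at every point, `J`,
`m ≥ 1`, `V ⊆ X` open (non-empty), `x ∈ V` a closed point such that every point of order `≥ m` of `J` is `x` or lies outside `V`, with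
`ord_x J = m`, embedding dimension `3`, `τ_x(J, m) ≥ 2` and `𝒪_{X,x}` a G-ring.  Then the conclusion of X44c holds on `V`: some CLEAN-permissible
sequence for `(J|_V, m)` and the line of `G|_V` brings the order below `m`.  Otherwise `exists_next_clean` never stops and yields an infinite
chain of `τ = 2` near points over the isolated point `x` of `Σ`, contradicting ✓ `false_of_nearChain_tau_two`.  Clean twin of
✓ `CampaignW46.orderReducible_comap_of_isolated_two_le_tau`. [cite: CossartPiltant2008, proof of Prop. 4.4] -/
theorem exists_isCleanPermissibleSeq_lt_comap_of_isolated_two_le_tau {p : ℕ} (hp : p.Prime) {X : Scheme.{0}} [IsIntegral X]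
    [IsLocallyNoetherian X] [CharP X.functionField p] (hX : Scheme.IsRegular X) (J : X.IdealSheafData) {m : ℕ} (hm : 1 ≤ m)
    (G : X.functionField) (hG : ∀ x : X, CleanRegAt p (algebraMap (X.presheaf.stalk x) X.functionField) G)
    (V : X.Opens) (x : X) (hxV : x ∈ V) (hcl : IsClosed ({x} : Set X))
    (hbad : ∀ z : X, (m : ℕ∞) ≤ idealOrder J z → z = x ∨ z ∉ (V : Set X))
    (hord : idealOrder J x = m) (hdim : (maximalIdeal (X.presheaf.stalk x)).spanFinrank = 3)
    (hτ : haveI := hX x; 2 ≤ stalkTau J x m) (hGr : IsGRing (X.presheaf.stalk x))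
    [IsIntegral ((V : X.Opens) : Scheme.{0})] [IsDominant V.ι] :
    ∃ (V' : Scheme.{0}) (π : V' ⟶ V) (_ : IsIntegral V') (_ : IsDominant π) (K' : V'.IdealSheafData),
      IsCleanPermissibleSeq p π (J.comap V.ι) m K' (RatFn.functionFieldMap V.ι G) ∧ ∀ y, idealOrder K' y < m := by
  classical
  by_contra hnot
  -- the initial stage, with clean data
  let σ₀ : TauTwoChainState X J m V :=
    ⟨X, J, x, 𝟙 X, inferInstance, hX, CampaignW46.IsPermissibleBlowupSeq.nil, hcl,
      fun z hz => (hbad z hz).imp id fun h => by simpa using h, hord, hdim, hτ⟩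
  have P0 : ∃ (_ : IsIntegral σ₀.X) (_ : IsDominant σ₀.Φ), IsCleanPermissibleSeq p σ₀.Φ J m σ₀.J G :=
    ⟨inferInstanceAs (IsIntegral X), inferInstanceAs (IsDominant (𝟙 X)), IsCleanPermissibleSeq.nil J m G⟩
  -- the step on states with clean data
  have step : ∀ s : {σ : TauTwoChainState X J m V //
        ∃ (_ : IsIntegral σ.X) (_ : IsDominant σ.Φ), IsCleanPermissibleSeq p σ.Φ J m σ.J G},
      ∃ (s' : {σ : TauTwoChainState X J m V //
          ∃ (_ : IsIntegral σ.X) (_ : IsDominant σ.Φ), IsCleanPermissibleSeq p σ.Φ J m σ.J G}) (π : s'.1.X ⟶ s.1.X),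
        IsBlowup π (vanishingIdeal ⟨{s.1.x}, s.1.closed⟩) ∧
        s'.1.J = controlledTransform π (vanishingIdeal ⟨{s.1.x}, s.1.closed⟩) s.1.J m ∧
        π s'.1.x = s.1.x ∧ IsNear π (vanishingIdeal ⟨{s.1.x}, s.1.closed⟩) s.1.J m s'.1.x ∧
        (haveI := s.1.reg s.1.x; stalkTau s.1.J s.1.x m = 2) := by
    rintro ⟨σ, hI, hDom, hc⟩
    haveI := hI
    haveI := hDom
    obtain ⟨σ', π, hI', hD', hc', hπ, hJ, hx, hnear, hτ'⟩ := exists_next_clean hp hX hG hm hnot σ hc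
    exact ⟨⟨σ', hI', hD', hc'⟩, π, hπ, hJ, hx, hnear, hτ'⟩
  choose next πn hπn hJn hxn hnearn hτn using step
  let chain : ℕ → {σ : TauTwoChainState X J m V //
      ∃ (_ : IsIntegral σ.X) (_ : IsDominant σ.Φ), IsCleanPermissibleSeq p σ.Φ J m σ.J G} :=
    fun n => Nat.rec ⟨σ₀, P0⟩ (fun _ s => next s) n
  have chain_succ : ∀ n, chain (n + 1) = next (chain n) := fun n => rfl
  let Xs : ℕ → Scheme.{0} := fun n => (chain n).1.X
  let π : ∀ n, Xs (n + 1) ⟶ Xs n := fun n => πn (chain n)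
  let y : ∀ n, Xs (n + 1) := fun n => (chain (n + 1)).1.x
  let Js : ∀ n, (Xs n).IdealSheafData := fun n => (chain n).1.J
  haveI : ∀ n, IsLocallyNoetherian (Xs n) := fun n => (chain n).1.locNoeth
  have e : ∀ n, π n (y n) = (chain n).1.x := fun n => hxn (chain n)
  have hy : ∀ n, π (n + 1) (y (n + 1)) = y n := fun n => e (n + 1)
  have hcls : ∀ n, IsClosed ({π n (y n)} : Set (Xs n)) := fun n => by rw [e n]; exact (chain n).1.closed
  have hC : ∀ n, (⟨{π n (y n)}, hcls n⟩ : Closeds (Xs n)) = ⟨{(chain n).1.x}, (chain n).1.closed⟩ := fun n =>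
    Closeds.ext (by simp [e n])
  have hregb : ∀ n, IsRegularLocalRing ((Xs n).presheaf.stalk (π n (y n))) := fun n => (chain n).1.reg _
  have hreg : ∀ n, IsRegularLocalRing ((Xs (n + 1)).presheaf.stalk (y n)) := fun n => (chain (n + 1)).1.reg _
  refine false_of_nearChain_tau_two Xs π y Js hm hy hcls (fun n => ?_) hregb hreg (fun n => ?_) (fun n => ?_)
    (fun n => ?_) (fun n => ?_) (fun n => ?_) ?_ ?_ ?_
  · -- the blowing up of the point
    rw [hC n]; exact hπn (chain n)
  · -- embedding dimension `3`
    rw [spanFinrank_maximalIdeal_congr (e n)]; exact (chain n).1.dim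
  · -- the controlled transform
    rw [hC n]; exact hJn (chain n)
  · -- nearness
    rw [hC n]; exact hnearn (chain n)
  · -- `τ(x_n) = 2`
    have h := hτn (chain n)
    rw [← stalkTau_congr (chain n).1.reg (chain n).1.J m (e n)] at h
    exact h
  · -- `τ(x_{n+1}) = 2`, read at `y_n = x_{n+1}`
    exact hτn (chain (n + 1))
  · -- `ord_{x_0} J_0 ≥ m`
    rw [← le_idealOrder_iff]
    have h0 : idealOrder (Js 0) ((chain 0).1.x) = m := hord
    rw [e 0, h0]
  · -- `𝒪_{X,x_0}` is a G-ring
    exact isGRing_stalk_congr (e 0).symm hGr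
  · -- `x_0` is isolated in `Σ`: generizations of `x` lie in the open `V`
    intro 𝔮 _ h𝔮
    refine not_map_le_pow_of_isolated (Js 0) (π 0 (y 0)) m (fun ζ hζ hne hle => ?_) 𝔮 h𝔮
    rw [e 0] at hζ hne
    have hζ' : ζ ⤳ x := hζ
    rcases hbad ζ hle with h | h
    · exact hne h
    · exact h (hζ'.mem_open V.2 hxV)

/-! ## §3 The clean isolated `τ ≥ 2` slice -/

/-- **THE CLEAN ISOLATED `τ ≥ 2` SLICE.**  `X` integral regular locally Noetherian, `char K(X) = p`, the line of `G` clean-regular at every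
point, `J` an ideal sheaf, `m ≥ 1`.  Suppose every point of `X` of order `≥ m` lies in a finite set `S` of closed points, and at every `x ∈ S`:
`ord_x J = m`, the embedding dimension of `𝒪_{X,x}` is `3`, Hironaka's `τ_x(J, m) ≥ 2`, and `𝒪_{X,x}` is a G-ring (e.g. `X` quasi-excellent).
Then some CLEAN-permissible sequence for `(J, m)` and the line of `G` — indeed one of successive blowing ups of closed points — brings the order
below `m` everywhere (the conclusion of X44c for this input): clean finite patching (✓ `exists_isCleanPermissibleSeq_lt_of_finite_of_forall_nhds`)
of the branches `exists_isCleanPermissibleSeq_lt_comap_of_isolated_two_le_tau` on `V = X ∖ (S ∖ {x})`.  Clean twin of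
✓ `CampaignW46.orderReducible_of_finite_two_le_tau`. [cite: CossartPiltant2008, Prop. 4.4 (proof, cases τ = 2, 3)] -/
theorem exists_isCleanPermissibleSeq_lt_of_finite_two_le_tau {p : ℕ} (hp : p.Prime) {X : Scheme.{0}} [IsIntegral X]
    [IsLocallyNoetherian X] [CharP X.functionField p] (hX : Scheme.IsRegular X) (J : X.IdealSheafData) {m : ℕ} (hm : 1 ≤ m)
    (G : X.functionField) (hG : ∀ x : X, CleanRegAt p (algebraMap (X.presheaf.stalk x) X.functionField) G)
    (S : Set X) (hS : S.Finite) (hSc : ∀ x ∈ S, IsClosed ({x} : Set X))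
    (hJS : ∀ x : X, (m : ℕ∞) ≤ idealOrder J x → x ∈ S) (hord : ∀ x ∈ S, idealOrder J x = m)
    (hdim : ∀ x ∈ S, (maximalIdeal (X.presheaf.stalk x)).spanFinrank = 3)
    (hτ : ∀ x ∈ S, haveI := hX x; 2 ≤ stalkTau J x m) (hGr : ∀ x ∈ S, IsGRing (X.presheaf.stalk x)) :
    ∃ (X' : Scheme.{0}) (Φ : X' ⟶ X) (_ : IsIntegral X') (_ : IsDominant Φ) (J' : X'.IdealSheafData),
      IsCleanPermissibleSeq p Φ J m J' G ∧ ∀ x, idealOrder J' x < m := by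
  refine exists_isCleanPermissibleSeq_lt_of_finite_of_forall_nhds J G S hS hSc hJS fun x hx => ?_
  -- the open `V = X ∖ (S ∖ {x})` isolates the branch of `x`
  have hcl : IsClosed (S \ {x}) :=
    isClosed_of_finite_of_isClosed_singleton (hS.subset Set.sdiff_subset) fun y hy => hSc y hy.1
  let V : X.Opens := ⟨(S \ {x})ᶜ, hcl.isOpen_compl⟩
  have hxV : x ∈ V := fun h => h.2 rfl
  refine ⟨V, hxV, fun {_ _} => exists_isCleanPermissibleSeq_lt_comap_of_isolated_two_le_tau hp hX J hm G hG V x hxV (hSc x hx)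
    (fun z hz => ?_) (hord x hx) (hdim x hx) (hτ x hx) (hGr x hx)⟩
  by_cases hzx : z = x
  · exact Or.inl hzx
  · exact Or.inr fun h => h ⟨hJS z hz, hzx⟩

end Summit.ResolutionOfSingularities.ResolutionOfSingularities.Theorems.RadicialJung.CleanModels

end
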